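/-
Copyright (c) 2026 the pub-hodgecm-mathlib formalisation cell (harness21).  Prover seat hodgecm-mathlib-B-p04 (g61), req618 STAGE 1a «FOUR-FRAME» squad, Track A TIER 2
for the tier-1 socket `U1_Frames` (this seat's unit as assembler, cand v2 e7b07868a0ec7c84): the payment of `stub_U1_normOneSq_depth_parity` — DEPTH PARITY OF NORM-ONE SQUARES.  2026-09-03.
-/
import Literature.NumberTheory.Automorphic.UnitaryThreeFourFrameFixedCosetDictionary    -- ★ p854570 (B-p04): `v_eq_one_of_mul_map_eq_one`; brings ★ #0a DEFS-1 `IsRamifiedQuadraticDatum`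
import HarnessLib

/-!
# (D-RAM) «FOUR-FRAME» road, unit (i), TIER 2: at a ramified quadratic datum, the DEPTH of the square of a norm-one unit has the parity of the different exponent —
# `a·σa = 1`, `a² ≠ 1`, `|a² − 1| = |ϖ|^n ⇒ n ≡ d (mod 2)` (payment of `U1_Frames.stub_U1_normOneSq_depth_parity`)

Cell `pub/hodgecm-mathlib` (D-0151), crux H413 = `stmt-HodgeConjecture-24833`, organ (D-RAM) `stub_DyRamCore`, «FOUR-FRAME» road, Track A (LEAD T17-31 (R-9)); tier-1 socket
`Cruxes/H413/Lines/F0_P3c_DyRamFourFrame/U1_Frames.lean` (assembler B-p04), stub **`stub_U1_normOneSq_depth_parity`** — the sheet's remark «`B_i ∈ ℤ`, parity automatic on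
`E¹ ∩ (1 + 𝔭^d)`» behind (D-CΔ)'s parity binder `2B = n_i − d + 2 − 2t_E`: all three depths `n₁ = v(b²−1)`, `n₂ = v(a²−1)`, `n₃ = v(a²−b²) = v((a∕b)²−1)` of the element datum are
depths of SQUARES of norm-one units, and those have the parity of `d`.

THE MATHEMATICS ([Serre1979, Ch. V §3]: ramified quadratic extensions, the different `𝔇 = (ϖ − σϖ)`; [Rogawski1990, §4.9 p. 55]).  For `a` with `a·σa = 1`: `a² − 1 = a² − a·σa =
a·(a − σa)` and `|a| = 1`, so `|a² − 1| = |a − σa|`.  The element `y = a − σa` is SKEW (`σy = −y`), as is `δ = ϖ − σϖ` (`|δ| = |ϖ|^d`, datum conjunct 5); hence `y∕δ` is `σ`-FIXED and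
non-zero, so `|y∕δ| = exp(2m)` for some `m ∈ ℤ` (datum conjunct 4: `σ`-fixed elements have even valuation — `e = 2`).  Therefore `exp(−n) = |a² − 1| = |y| = exp(2m − d)`, i.e.
`n = d − 2m ≡ d (mod 2)`.  (For a norm-one unit that is NOT a square, `u = x∕σx` with `|x|` odd, the other parity occurs — `u = ϖ∕σϖ` has depth exactly `d − 1`; the sheet's
«canonical square roots» are what makes the parity automatic.)

* §1 `valued_eq_exp_sub_of_skew` (every non-zero skew element has valuation `exp(2m − d)`), `mul_self_sub_one_eq` (`a² − 1 = a(a − σa)`).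
* §2 **`normOneSq_depth_parity`** — `U1_Frames.stub_U1_normOneSq_depth_parity` TOKEN FOR TOKEN.

HONEST LABEL: HC_CM is proved only modulo the 7 printed citations (2 remaining named inputs: hLiu418 = stmt-HodgeConjecture-24832, h413 = stmt-HodgeConjecture-24833) until rung 0
closes; `--supports stmt-HodgeConjecture-24833` helper; valuation arithmetic only.
-/

noncomputable section

open scoped Valued WithZero

namespace Summit.HodgeConjecture.HodgeConjecture.Cruxes.H413.F0P3cDyRamNormOneSqDepthParity

open Literature.NumberTheory.Automorphic Literature.NumberTheory.Automorphic.UnitaryThreeFourFrame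

variable {K : Type} [Field K] [Valued K ℤᵐ⁰]

/-! ## §1  Skew elements at a ramified quadratic datum -/

/-- **Every non-zero SKEW element has valuation `exp(2m − d)`**: at a ramified quadratic datum (`σ`-fixed elements have even valuation, `|ϖ − σϖ| = |ϖ|^d`), `σy = −y`, `y ≠ 0`
⇒ `∃ m : ℤ, |y| = exp(2m − d)` (divide by the skew `δ = ϖ − σϖ`: `y∕δ` is fixed). [cite: Serre1979, Ch. V §3] -/
theorem valued_eq_exp_sub_of_skew {σ : K →+* K} {ϖ : K} {d t : ℕ} (hD : IsRamifiedQuadraticDatum σ ϖ d t) {y : K} (hy : σ y = -y) (hy0 : y ≠ 0) :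
    ∃ m : ℤ, Valued.v y = WithZero.exp (2 * m - (d : ℤ)) := by
  obtain ⟨hσσ, -, hϖ, heven, hδ, -, -⟩ := hD
  set δ : K := ϖ - σ ϖ with hδ_def
  have hvδ : Valued.v δ = WithZero.exp (-(d : ℤ)) := by
    rw [hδ, hϖ, ← WithZero.exp_nsmul, nsmul_eq_mul, mul_neg, mul_one]
  have hδ0 : δ ≠ 0 := fun h => by
    rw [h, map_zero] at hvδ
    exact WithZero.zero_ne_coe hvδ
  have hσδ : σ δ = -δ := by
    simp only [hδ_def, map_sub, hσσ, neg_sub]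
  -- `y / δ` is fixed and non-zero
  have hfix : σ (y / δ) = y / δ := by rw [map_div₀, hy, hσδ, neg_div_neg_eq]
  have hne : y / δ ≠ 0 := div_ne_zero hy0 hδ0
  obtain ⟨m, hm⟩ := heven (y / δ) hfix hne
  refine ⟨m, ?_⟩
  have hy_eq : y = y / δ * δ := (div_mul_cancel₀ y hδ0).symm
  rw [hy_eq, map_mul, hm, hvδ, ← WithZero.exp_add]
  congr 1

omit [Valued K ℤᵐ⁰] in
/-- `a·σa = 1 ⇒ a² − 1 = a·(a − σa)`. [cite: Rogawski1990, §4.9 p. 55] -/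
theorem mul_self_sub_one_eq {σ : K →+* K} {a : K} (ha : a * σ a = 1) : a * a - 1 = a * (a - σ a) := by
  rw [mul_sub, ha]

/-! ## §2  The head -/

/-- **PAYMENT OF `stub_U1_normOneSq_depth_parity`** (tier-1 socket `U1_Frames`, unit (i)): at a ramified quadratic datum `(σ, ϖ, d, t)` on a complete `K`, for every norm-one
`a` (`a·σa = 1`) with `a² ≠ 1`: `|a² − 1| = |ϖ|^n ⇒ n ≡ d (mod 2)`.  (`a² − 1 = a(a − σa)`, `|a| = 1`, `a − σa` skew and non-zero, §1.) [cite: Serre1979, Ch. V §3] [cite: Rogawski1990, §4.9 p. 55] -/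
theorem normOneSq_depth_parity :
    ∀ {K : Type} [Field K] [Valued K ℤᵐ⁰] [CompleteSpace K] (σ : K →+* K) (ϖ : K) (d t : ℕ), IsRamifiedQuadraticDatum σ ϖ d t →
      ∀ (a : K), a * σ a = 1 → a * a ≠ 1 → ∀ n : ℕ, Valued.v (a * a - 1) = Valued.v ϖ ^ n → n % 2 = d % 2 := by
  intro K _ _ _ σ ϖ d t hD a ha haa n hn
  have hvσ : ∀ x, Valued.v (σ x) = Valued.v x := hD.2.1
  have hϖ : Valued.v ϖ = WithZero.exp (-1 : ℤ) := hD.2.2.1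
  have hσσ : ∀ x, σ (σ x) = x := hD.1
  have hva : Valued.v a = 1 := v_eq_one_of_mul_map_eq_one hvσ ha
  -- the skew element `y = a − σa`
  have hy : σ (a - σ a) = -(a - σ a) := by rw [map_sub, hσσ, neg_sub]
  have hy0 : a - σ a ≠ 0 := fun h => haa (by rw [← sub_eq_zero, mul_self_sub_one_eq ha, h, mul_zero])
  obtain ⟨m, hm⟩ := valued_eq_exp_sub_of_skew hD hy hy0
  -- compare the two expressions of `|a² − 1|`
  have h1 : Valued.v (a * a - 1) = WithZero.exp (2 * m - (d : ℤ)) := by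
    rw [mul_self_sub_one_eq ha, map_mul, hva, one_mul, hm]
  have h2 : Valued.v (a * a - 1) = WithZero.exp (-(n : ℤ)) := by
    rw [hn, hϖ, ← WithZero.exp_nsmul, nsmul_eq_mul, mul_neg, mul_one]
  have h3 : (2 * m - (d : ℤ)) = -(n : ℤ) := WithZero.exp_injective (h1.symm.trans h2)
  omega

end Summit.HodgeConjecture.HodgeConjecture.Cruxes.H413.F0P3cDyRamNormOneSqDepthParity

end
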